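import Summits.NavierStokesRegularity.FunctionalMining.NoGo.TopEigHeatFrameFloor
import Summits.NavierStokesRegularity.FunctionalMining.TopEigSimpleGap
import HarnessLib

/-!
# FunctionalMining / NoGo — K63: the FRAME DENSITY on the simple set and the FATOU LOCALISATION
# of the frame cost (door (e), DOOR-E-SPEC § 4 / § 12)

HONEST FRAMING. Search for candidate a priori estimates; no regularity claim. This file decides
no `@[conjecture]` node; it continues the no-go seat's bookkeeping of WHAT a killing family for
Lemma L-λ(q) (`TopEigHeatCoercivePos q`) must pay (no-go seat gen 54, touch 3).

WHAT K62 LEFT OPEN. `NoGo/TopEigHeatFrameFloor` (K62) split the heat dissipation of `Φ_q = ∫ λ₁^q`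
(`q ≥ 2`) EXACTLY into the amplitude term `AF_q(v) = Σᵢ ∫ q(q−1)λ₁^{q−2}(∂ᵢλ₁)²` and the FRAME COST
`FC_q(v) = lim_{t→0+} t⁻² ∫ qλ₁^{q−1} FD_t ≥ 0`, with `FD_t(x) ≥ 0` the discrete frame defect; the
pointwise identification of `t⁻² FD_t(x)` was NOT claimed there. This file proves it where it is
true without any global hypothesis — on the SIMPLE SET `U_s(v) = {x : λ₂(x) < λ₁(x)}` (open) — and
localises the frame cost there by Fatou:

* § 1 (one variable, [folklore]) `(ℓ(t)+ℓ(−t)−2ℓ(0))/t² → ℓ″(0)` whenever `ℓ` is differentiable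
  near `0` and `ℓ′` is differentiable at `0` (mean-value bound on `ℓ(s)+ℓ(−s)−2ℓ(0)−ℓ″(0)s²`).
* § 2 THE FRAME DENSITY `fd(x) := Δλ₁(x) − μ(S(x); S_{Δv}(x))` (`μ(A;M)` = the top directional
  derivative `dirTopEig`). On `U_s(v)`: `t⁻² FD_t(x) → fd(x)` as `t → 0, t ≠ 0`
  (`tendsto_frameDefect_div_sq`; the `λ₁`-part by § 1 and the tree's local smoothness of `λ₁` at
  simple points (`TopEigSimpleGap`), the `μ`-part — for EVERY `x` and every `d` — by K62's cubic
  Taylor bound and the Lipschitz/homogeneity of `μ`); hence `fd ≥ 0` on `U_s(v)`; and, re-exporting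
  the tree's channel identity (`TopEigChannelIntegralSimple`), `fd(x) = 2 Σₖ (λ₁|N′ₖ|² − N′ₖᵀ S N′ₖ)`
  with every summand `≥ 0` (`N′ₖ` = the axis-`k` derivative of the top eigenvector; each summand is a
  Rayleigh defect `Σ_{a≠1} (λ₁−λ_a)(u_a·N′ₖ)²`): the frame cost density IS the gap-weighted turning
  rate of the top eigenframe, as DOOR-E-SPEC § 4 asserted on paper.
* § 3 FATOU LOCALISATION (`q ≥ 2`, smooth divergence-free `v` on `T³`):
  `∫_{U_s(v)} qλ₁^{q−1} fd ≤ FC_q(v)` (`setIntegral_simpleSet_frameDensity_le_frameCost`, with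
  integrability of the weighted density on `U_s(v)`), and `= FC_q(v)` over the whole torus when every
  point is simple (`frameCost_eq_integral_of_simple`, from the tree's smooth heat identity).
* § 4 KILL RULE. `heatDissipation Φ_q v ≤ c Φ_q(v)` forces `∫_{U_s(v)} qλ₁^{q−1} fd ≤ c Φ_q(v)`: along a
  killing family the gap-weighted frame turning must be `o(Φ_q)` on the simple set — door (e)'s frame
  half, now with NO simplicity hypothesis on the family (the non-simple set only adds a nonnegative,
  unidentified amount to `FC_q`).

NOT CLAIMED: the value of the defect of Fatou (the contribution of `{λ₂ = λ₁}` and of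
concentration near it) — only `≤`; nothing for `1 < q < 2`; no node of the tree is decided here.
Every decl below carries its own docstring; `[folklore]` marks standard real analysis.
FILING (prove seat g30, REQUEST #92): declarations byte-identical to the no-go seat's staged `TopEigHeatFrameDensity.STAGING.lean` 077262d98a6ce5dd; this line is the only addition.
-/

noncomputable section

open MeasureTheory Set Filter Topology Matrix
open scoped ContDiff ENNReal

namespace Summit.NavierStokesRegularity.FunctionalMining

open Literature.Analysis.FunctionSpaces Literature.Analysis.FluidPDE

namespace TopEig

namespace FrameFloor

open StrainL4

/-! ## § 1 One real variable: the symmetric second difference quotient [folklore] -/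

/-- [folklore] If `ℓ : ℝ → ℝ` is differentiable near `0` and `ℓ′ = deriv ℓ` has derivative `a` at
`0`, then `(ℓ(t) + ℓ(−t) − 2ℓ(0))/t² → a` as `t → 0`, `t ≠ 0`. Proof: `ψ(s) = ℓ(s)+ℓ(−s)−2ℓ(0)−as²`
has `|ψ′(s)| ≤ (ε/2)|t|` on `[0,t]` for `|t|` small (little-o of `ℓ′` at `0`), so `|ψ(t)| ≤ (ε/2)t²`. -/
theorem tendsto_symm_second_diff_div_sq {ℓ : ℝ → ℝ} {a : ℝ}
    (hd : ∀ᶠ s in 𝓝 (0 : ℝ), DifferentiableAt ℝ ℓ s) (h2 : HasDerivAt (deriv ℓ) a 0) :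
    Tendsto (fun t : ℝ => (ℓ t + ℓ (-t) - 2 * ℓ 0) / t ^ 2) (𝓝[≠] 0) (𝓝 a) := by
  rw [Metric.tendsto_nhdsWithin_nhds]
  intro ε hε
  have hε4 : (0 : ℝ) < ε / 4 := by positivity
  obtain ⟨δ, hδ, hball⟩ :=
    Metric.eventually_nhds_iff.1 (hd.and ((hasDerivAt_iff_isLittleO.1 h2).def hε4))
  refine ⟨δ, hδ, fun t ht htδ => ?_⟩
  have ht0 : t ≠ 0 := ht
  have htabs : |t| < δ := by simpa [Real.dist_eq] using htδ
  -- the data at the points `s` with `|s| ≤ |t|`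
  have hpt : ∀ s : ℝ, |s| ≤ |t| →
      DifferentiableAt ℝ ℓ s ∧ |deriv ℓ s - deriv ℓ 0 - s * a| ≤ ε / 4 * |s| := by
    intro s hs
    have h := @hball s (by rw [Real.dist_eq, sub_zero]; exact lt_of_le_of_lt hs htabs)
    exact ⟨h.1, by simpa [Real.norm_eq_abs, smul_eq_mul] using h.2⟩
  set ψ : ℝ → ℝ := fun s => ℓ s + ℓ (-s) - 2 * ℓ 0 - a * (s * s) with hψ
  have hder : ∀ s ∈ uIcc (0 : ℝ) t,
      HasDerivWithinAt ψ (deriv ℓ s - deriv ℓ (-s) - 2 * a * s) (uIcc (0 : ℝ) t) s := by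
    intro s hs
    have hs' : |s| ≤ |t| := by simpa using Set.abs_sub_left_of_mem_uIcc hs
    have h1 : HasDerivAt ℓ (deriv ℓ s) s := (hpt s hs').1.hasDerivAt
    have h2 : HasDerivAt (fun u : ℝ => ℓ (-u)) (deriv ℓ (-s) * -1) s :=
      ((hpt (-s) (by rwa [abs_neg])).1.hasDerivAt).comp s (hasDerivAt_neg s)
    have h3 : HasDerivAt (fun u : ℝ => a * (u * u)) (a * (1 * s + s * 1)) s :=
      ((hasDerivAt_id s).mul (hasDerivAt_id s)).const_mul a
    have h : HasDerivAt ψ (deriv ℓ s + deriv ℓ (-s) * -1 - a * (1 * s + s * 1)) s :=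
      ((h1.add h2).sub_const (2 * ℓ 0)).sub h3
    exact (h.congr_deriv (by ring)).hasDerivWithinAt
  have hbd : ∀ s ∈ uIcc (0 : ℝ) t, ‖deriv ℓ s - deriv ℓ (-s) - 2 * a * s‖ ≤ ε / 2 * |t| := by
    intro s hs
    have hs' : |s| ≤ |t| := by simpa using Set.abs_sub_left_of_mem_uIcc hs
    have hA := (hpt s hs').2
    have hB := (hpt (-s) (by rwa [abs_neg])).2
    rw [abs_neg] at hB
    have hsplit : deriv ℓ s - deriv ℓ (-s) - 2 * a * s =
        (deriv ℓ s - deriv ℓ 0 - s * a) - (deriv ℓ (-s) - deriv ℓ 0 - (-s) * a) := by ring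
    rw [Real.norm_eq_abs, hsplit]
    refine (abs_sub _ _).trans ?_
    nlinarith [hA, hB, hs', hε]
  have hmvt := (convex_uIcc (0 : ℝ) t).norm_image_sub_le_of_norm_hasDerivWithin_le hder hbd
    left_mem_uIcc right_mem_uIcc
  have hψ0 : ψ 0 = 0 := by
    show ℓ 0 + ℓ (-0) - 2 * ℓ 0 - a * (0 * 0) = 0
    rw [neg_zero]; ring
  simp only [hψ0, sub_zero, Real.norm_eq_abs] at hmvt
  have ht2 : 0 < t ^ 2 := by positivity
  have hkey : (ℓ t + ℓ (-t) - 2 * ℓ 0) / t ^ 2 - a = ψ t / t ^ 2 := by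
    simp only [hψ]
    field_simp
  rw [Real.dist_eq, hkey, abs_div, abs_of_pos ht2, div_lt_iff₀ ht2]
  calc |ψ t| ≤ ε / 2 * |t| * |t| := hmvt
    _ = ε / 2 * t ^ 2 := by rw [mul_assoc, abs_mul_abs_self, sq]
    _ < ε * t ^ 2 := by nlinarith

/-! ## § 2 The frame density and the pointwise limit of `t⁻² FD_t` on the simple set -/

section AnyDim

variable {d : Type*} [Fintype d] [DecidableEq d] [Nonempty d]
variable {v : UnitAddTorus d → EuclideanSpace ℝ d}

/-- THE FRAME DENSITY `fd(x) := Δλ₁(x) − μ(S(x); S_{Δv}(x))`: the Laplacian of the top strain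
eigenvalue minus the top directional derivative of the top eigenvalue at `S(x)` in the direction of
the strain of `Δv` (`= u₁ᵀ S_{Δv} u₁` at simple points). Meaningful where `λ₁` is twice
differentiable (e.g. on the simple set); elsewhere `Δλ₁(x)` is Mathlib's junk value. -/
def frameDensity (v : UnitAddTorus d → EuclideanSpace ℝ d) (x : UnitAddTorus d) : ℝ :=
  Torus.laplacian (torusStrainTopEig v) x -
    dirTopEig (strainFlat v x) (strainFlat (Torus.laplacian v) x)

/-- The directional half of the limit, valid at EVERY point and in every dimension:
`t⁻² μ(S(x); M_t(x)) → μ(S(x); S_{Δv}(x))` as `t → 0, t ≠ 0`, where `M_t = strainSecondDiff v t` —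
from K62's cubic bound `|μ(S;M_t) − t² μ(S;S_{Δv})| ≤ C|t|³`. -/
theorem tendsto_dirTopEig_strainSecondDiff_div_sq (hv : Torus.IsSmooth v) (x : UnitAddTorus d) :
    Tendsto (fun t : ℝ => dirTopEig (strainFlat v x) (strainSecondDiff v t x) / t ^ 2) (𝓝[≠] 0)
      (𝓝 (dirTopEig (strainFlat v x) (strainFlat (Torus.laplacian v) x))) := by
  obtain ⟨C, hC⟩ := exists_abs_dirTopEig_strainSecondDiff_sub_le hv
  set μ0 := dirTopEig (strainFlat v x) (strainFlat (Torus.laplacian v) x) with hμ0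
  have hb : Tendsto (fun t : ℝ => C * |t|) (𝓝[≠] (0 : ℝ)) (𝓝 0) := by
    have h : Tendsto (fun t : ℝ => C * |t|) (𝓝 (0 : ℝ)) (𝓝 (C * |(0 : ℝ)|)) :=
      tendsto_const_nhds.mul (continuous_abs.tendsto 0)
    rw [abs_zero, mul_zero] at h
    exact h.mono_left nhdsWithin_le_nhds
  refine tendsto_sub_nhds_zero_iff.1 (squeeze_zero_norm' ?_ hb)
  filter_upwards [self_mem_nhdsWithin] with t ht
  have ht0 : t ≠ 0 := ht
  have ht2 : 0 < t ^ 2 := by positivity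
  rw [Real.norm_eq_abs, show dirTopEig (strainFlat v x) (strainSecondDiff v t x) / t ^ 2 - μ0 =
      (dirTopEig (strainFlat v x) (strainSecondDiff v t x) - t ^ 2 * μ0) / t ^ 2 by
    rw [sub_div, mul_div_cancel_left₀ _ ht2.ne'], abs_div, abs_of_pos ht2, div_le_iff₀ ht2]
  calc |dirTopEig (strainFlat v x) (strainSecondDiff v t x) - t ^ 2 * μ0|
      ≤ C * |t| ^ 3 := hC x t
    _ = C * |t| * t ^ 2 := by rw [← sq_abs t]; ring

end AnyDim

section Three

variable {v : UnitAddTorus (Fin 3) → EuclideanSpace ℝ (Fin 3)} {q : ℝ}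

/-- THE SIMPLE SET `U_s(v) := {x : λ₂(x) < λ₁(x)}` of a field on `T³` (top strain eigenvalue simple). -/
def simpleSet (v : UnitAddTorus (Fin 3) → EuclideanSpace ℝ (Fin 3)) : Set (UnitAddTorus (Fin 3)) :=
  {x | torusStrainMidEig v x < torusStrainTopEig v x}

/-- The simple set of a smooth field is open (re-export of the tree's
`isOpen_setOf_midEig_lt_topEig`). -/
theorem isOpen_simpleSet (hv : Torus.IsSmooth v) : IsOpen (simpleSet v) :=
  isOpen_setOf_midEig_lt_topEig hv

/-- The `λ₁`-half of the limit at a simple point: `t⁻² Σₖ (λ₁(x+tεₖ)+λ₁(x−tεₖ)−2λ₁(x)) → Δλ₁(x)`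
as `t → 0, t ≠ 0` — § 1 on each axis line, using the tree's `C^∞` smoothness of `λ₁` at simple points
(`contDiffAt_liftAt_torusStrainTopEig_of_midEig_lt`) and its chart formula for the Laplacian. -/
theorem tendsto_topEigSecondDiff_div_sq (hv : Torus.IsSmooth v) {x : UnitAddTorus (Fin 3)}
    (hx : x ∈ simpleSet v) :
    Tendsto (fun t : ℝ => topEigSecondDiff v t x / t ^ 2) (𝓝[≠] 0)
      (𝓝 (Torus.laplacian (torusStrainTopEig v) x)) := by
  have hcd : ContDiffAt ℝ ∞ (Torus.liftAt (torusStrainTopEig v) x) 0 :=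
    contDiffAt_liftAt_torusStrainTopEig_of_midEig_lt hv hx
  have hcd2 : ContDiffAt ℝ 2 (Torus.liftAt (torusStrainTopEig v) x) 0 :=
    hcd.of_le (WithTop.coe_le_coe.2 le_top)
  rw [laplacian_eq_sum_partialDeriv_partialDeriv_of_contDiffAt hcd2]
  simp only [partialDeriv_partialDeriv_eq_deriv_deriv]
  have hsum : (fun t : ℝ => topEigSecondDiff v t x / t ^ 2) = fun t => ∑ k : Fin 3,
      (torusStrainTopEig v (x + Torus.proj (t • EuclideanSpace.single k (1 : ℝ))) +
        torusStrainTopEig v (x + Torus.proj ((-t) • EuclideanSpace.single k (1 : ℝ))) -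
        2 * torusStrainTopEig v x) / t ^ 2 := by
    funext t; rw [topEigSecondDiff, Finset.sum_div]
  rw [hsum]
  refine tendsto_finsetSum _ fun k _ => ?_
  set K : EuclideanSpace ℝ (Fin 3) := EuclideanSpace.single k (1 : ℝ) with hK
  set ℓ : ℝ → ℝ := fun u => torusStrainTopEig v (x + Torus.proj (u • K)) with hℓ
  have hcomp : ℓ = Torus.liftAt (torusStrainTopEig v) x ∘ fun u : ℝ => u • K := by
    funext u; simp [hℓ, Torus.liftAt_apply]
  have h2ℓ : ContDiffAt ℝ 2 ℓ 0 := by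
    rw [hcomp]
    refine ContDiffAt.comp (0 : ℝ) ?_ (contDiffAt_id.smul contDiffAt_const)
    simp only [zero_smul]
    exact hcd2
  have hdiff : ∀ᶠ s in 𝓝 (0 : ℝ), DifferentiableAt ℝ ℓ s := by
    filter_upwards [h2ℓ.eventually (by simp)] with s hs using hs.differentiableAt (by norm_num)
  have hdd : HasDerivAt (deriv ℓ) (deriv (deriv ℓ) 0) 0 :=
    (differentiableAt_deriv_of_contDiffAt h2ℓ).hasDerivAt
  refine Tendsto.congr (fun t => ?_) (tendsto_symm_second_diff_div_sq hdiff hdd)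
  simp only [hℓ, zero_smul, Torus.proj_zero, add_zero]

/-- **Pointwise identification on the simple set.** At a point where `λ₂ < λ₁`,
`t⁻² FD_t(x) → fd(x)` as `t → 0, t ≠ 0` (`FD_t = frameDefect v t`, K62). -/
theorem tendsto_frameDefect_div_sq (hv : Torus.IsSmooth v) {x : UnitAddTorus (Fin 3)}
    (hx : x ∈ simpleSet v) :
    Tendsto (fun t : ℝ => frameDefect v t x / t ^ 2) (𝓝[≠] 0) (𝓝 (frameDensity v x)) := by
  have h := (tendsto_topEigSecondDiff_div_sq hv hx).sub
    (tendsto_dirTopEig_strainSecondDiff_div_sq hv x)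
  exact h.congr' (Eventually.of_forall fun t => by simp only [frameDefect, sub_div])

/-- The frame density is nonnegative on the simple set (limit of `t⁻² FD_t ≥ 0`). -/
theorem frameDensity_nonneg_of_mem (hv : Torus.IsSmooth v) {x : UnitAddTorus (Fin 3)}
    (hx : x ∈ simpleSet v) : 0 ≤ frameDensity v x :=
  ge_of_tendsto' (tendsto_frameDefect_div_sq hv hx) fun t =>
    div_nonneg (frameDefect_nonneg v t x) (sq_nonneg t)

/-- **The frame density in channels** (re-export of the tree's `laplacian_sub_dirTopEig_eq_of_gapForm`
at a simple point): there are a unit top eigenvector `e` and vectors `N′ₖ` (`k = 0,1,2`; on paper the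
axis derivatives of the top eigenvector field) with
`fd(x) = 2 Σₖ (λ₁(x)|N′ₖ|² − N′ₖᵀ S(x) N′ₖ)` and every summand `≥ 0` — the gap-weighted turning rate of
the top eigenframe (`λ₁|w|² − wᵀSw = Σ_a (λ₁−λ_a)(u_a·w)²`). -/
theorem frameDensity_eq_channels (hv : Torus.IsSmooth v) {x : UnitAddTorus (Fin 3)}
    (hx : x ∈ simpleSet v) :
    ∃ (e : Fin 3 → ℝ) (N' : Fin 3 → Fin 3 → ℝ), e ⬝ᵥ e = 1 ∧
      torusStrainMatrix v x *ᵥ e = torusStrainTopEig v x • e ∧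
      frameDensity v x = 2 * ∑ k, (torusStrainTopEig v x * (N' k ⬝ᵥ N' k) -
        N' k ⬝ᵥ (torusStrainMatrix v x *ᵥ N' k)) ∧
      ∀ k, 0 ≤ torusStrainTopEig v x * (N' k ⬝ᵥ N' k) - N' k ⬝ᵥ (torusStrainMatrix v x *ᵥ N' k) := by
  obtain ⟨e, he1, hSe, hg, hgap⟩ := exists_gapForm_of_midEig_lt_topEig hx
  obtain ⟨N', hfd, hk, -⟩ := laplacian_sub_dirTopEig_eq_of_gapForm hv he1 hSe hg hgap
  refine ⟨e, N', he1, hSe, ?_, fun k => ?_⟩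
  · rw [frameDensity, hfd]
    exact congrArg _ (Finset.sum_congr rfl fun k _ => (hk k).1)
  · rw [← (hk k).1]; exact (hk k).2

/-! ## § 3 Fatou localisation of the frame cost on the simple set (`q ≥ 2`) -/

/-- The weighted grid quantities converge on the simple set:
`qλ₁(x)^{q−1} FD_t(x)/t² → qλ₁(x)^{q−1} fd(x)` as `t → 0+`. -/
theorem tendsto_weight_frameDefect_div_sq (hv : Torus.IsSmooth v) {x : UnitAddTorus (Fin 3)}
    (hx : x ∈ simpleSet v) (q : ℝ) :
    Tendsto (fun t : ℝ => q * torusStrainTopEig v x ^ (q - 1) * frameDefect v t x / t ^ 2)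
      (𝓝[>] 0) (𝓝 (q * torusStrainTopEig v x ^ (q - 1) * frameDensity v x)) := by
  have h := ((tendsto_frameDefect_div_sq hv hx).mono_left
    (nhdsWithin_mono _ fun t (ht : t ∈ Ioi (0 : ℝ)) => ne_of_gt ht)).const_mul
    (q * torusStrainTopEig v x ^ (q - 1))
  simpa only [mul_div_assoc] using h

/-- **Fatou localisation, `ℝ≥0∞` form.** For `q ≥ 2` and smooth divergence-free `v` on `T³`:
`∫⁻_{U_s(v)} qλ₁^{q−1} fd ≤ FC_q(v)` — Fatou along `t → 0+` applied to the nonnegative grid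
quantities `qλ₁^{q−1}FD_t/t²`, whose total integrals tend to the frame cost (K62). -/
theorem lintegral_simpleSet_frameDensity_le (hq : 2 ≤ q) (hv : Torus.IsSmooth v)
    (hdv : Torus.IsDivFree v) :
    ∫⁻ x in simpleSet v, ENNReal.ofReal (q * torusStrainTopEig v x ^ (q - 1) * frameDensity v x) ≤
      ENNReal.ofReal (frameCost q v) := by
  have hq1 : (1 : ℝ) ≤ q := one_le_two.trans hq
  have hlam : ∀ x, 0 ≤ torusStrainTopEig v x := fun x => by
    rw [← lam_strainFlat]; exact lam_strainFlat_nonneg hv hdv x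
  set g : ℝ → UnitAddTorus (Fin 3) → ℝ :=
    fun t x => q * torusStrainTopEig v x ^ (q - 1) * frameDefect v t x / t ^ 2 with hg
  have hg_int : ∀ t, Integrable (g t) volume := fun t =>
    (integrable_weight_mul_frameDefect hq1 hv t).div_const _
  have hg_nn : ∀ t x, 0 ≤ g t x := fun t x =>
    div_nonneg (mul_nonneg (mul_nonneg (by linarith) (Real.rpow_nonneg (hlam x) _))
      (frameDefect_nonneg v t x)) (sq_nonneg t)
  have hI : Tendsto (fun t => ∫ x, g t x) (𝓝[>] 0) (𝓝 (frameCost q v)) := by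
    refine Tendsto.congr (fun t => ?_) (tendsto_frameIntegral_div_sq hq hv hdv)
    simp only [hg, frameIntegral]
    exact (integral_div _ _).symm
  have hU : MeasurableSet (simpleSet v) := (isOpen_simpleSet hv).measurableSet
  calc ∫⁻ x in simpleSet v, ENNReal.ofReal (q * torusStrainTopEig v x ^ (q - 1) * frameDensity v x)
      = ∫⁻ x in simpleSet v, liminf (fun t => ENNReal.ofReal (g t x)) (𝓝[>] 0) := by
        refine setLIntegral_congr_fun hU fun x hx => ?_
        exact ((ENNReal.tendsto_ofReal (tendsto_weight_frameDefect_div_sq hv hx q)).liminf_eq).symm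
    _ ≤ liminf (fun t => ∫⁻ x in simpleSet v, ENNReal.ofReal (g t x)) (𝓝[>] 0) :=
        lintegral_liminf_le' fun t => (hg_int t).aemeasurable.ennreal_ofReal.restrict
    _ ≤ liminf (fun t => ∫⁻ x, ENNReal.ofReal (g t x)) (𝓝[>] 0) :=
        liminf_le_liminf (Eventually.of_forall fun t => setLIntegral_le_lintegral _ _)
    _ = liminf (fun t => ENNReal.ofReal (∫ x, g t x)) (𝓝[>] 0) :=
        liminf_congr (Eventually.of_forall fun t =>
          (ofReal_integral_eq_lintegral_ofReal (hg_int t) (ae_of_all _ (hg_nn t))).symm)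
    _ = ENNReal.ofReal (frameCost q v) := (ENNReal.tendsto_ofReal hI).liminf_eq

/-- **Fatou localisation of the frame cost** (`q ≥ 2`, smooth divergence-free `v` on `T³`): the
weighted frame density `qλ₁^{q−1} fd` is integrable on the simple set `U_s(v)` and
`∫_{U_s(v)} qλ₁^{q−1} fd ≤ FC_q(v) = heatDissipation Φ_q v − AF_q(v)`. -/
theorem setIntegral_simpleSet_frameDensity_le_frameCost (hq : 2 ≤ q) (hv : Torus.IsSmooth v)
    (hdv : Torus.IsDivFree v) :
    IntegrableOn (fun x => q * torusStrainTopEig v x ^ (q - 1) * frameDensity v x) (simpleSet v)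
        volume ∧
      ∫ x in simpleSet v, q * torusStrainTopEig v x ^ (q - 1) * frameDensity v x ≤ frameCost q v := by
  have hq1 : (1 : ℝ) ≤ q := one_le_two.trans hq
  have hlam : ∀ x, 0 ≤ torusStrainTopEig v x := fun x => by
    rw [← lam_strainFlat]; exact lam_strainFlat_nonneg hv hdv x
  have hU : MeasurableSet (simpleSet v) := (isOpen_simpleSet hv).measurableSet
  set G : UnitAddTorus (Fin 3) → ℝ :=
    fun x => q * torusStrainTopEig v x ^ (q - 1) * frameDensity v x with hG
  have hGm : AEStronglyMeasurable G (volume.restrict (simpleSet v)) :=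
    aestronglyMeasurable_of_tendsto_ae (𝓝[>] (0 : ℝ))
      (f := fun t x => q * torusStrainTopEig v x ^ (q - 1) * frameDefect v t x / t ^ 2)
      (fun t => ((integrable_weight_mul_frameDefect hq1 hv t).div_const _).aestronglyMeasurable.restrict)
      ((ae_restrict_iff' hU).2 (ae_of_all _ fun x hx => tendsto_weight_frameDefect_div_sq hv hx q))
  have hG0 : 0 ≤ᵐ[volume.restrict (simpleSet v)] G :=
    (ae_restrict_iff' hU).2 (ae_of_all _ fun x hx =>
      mul_nonneg (mul_nonneg (by linarith) (Real.rpow_nonneg (hlam x) _))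
        (frameDensity_nonneg_of_mem hv hx))
  have hlin := lintegral_simpleSet_frameDensity_le hq hv hdv
  have hfin : HasFiniteIntegral G (volume.restrict (simpleSet v)) := by
    rw [hasFiniteIntegral_iff_ofReal hG0]
    exact lt_of_le_of_lt hlin ENNReal.ofReal_lt_top
  refine ⟨⟨hGm, hfin⟩, ?_⟩
  rw [integral_eq_lintegral_of_nonneg_ae hG0 hGm]
  exact ENNReal.toReal_le_of_le_ofReal (frameCost_nonneg hq hv hdv) hlin

/-- **Everywhere-simple fields: the frame cost IS the integral of the weighted frame density.**
If `λ₂ < λ₁` at every point, then `FC_q(v) = ∫ qλ₁^{q−1} fd` (`q ≥ 2`) — from the tree's smooth heat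
identity `heatDissipation Φ_q v = ∫ (q(q−1)λ₁^{q−2}|∇λ₁|² + qλ₁^{q−1} fd)`
(`heatDissipation_topEigMoment_eq_integral_of_midEig_lt`) and K62's `FC_q = heat − AF_q`. -/
theorem frameCost_eq_integral_of_simple (hq : 2 ≤ q) (hv : Torus.IsSmooth v)
    (hdv : Torus.IsDivFree v) (hU : ∀ x, x ∈ simpleSet v) :
    frameCost q v = ∫ x, q * torusStrainTopEig v x ^ (q - 1) * frameDensity v x := by
  have hq1 : (1 : ℝ) ≤ q := one_le_two.trans hq
  obtain ⟨hheat, -, -⟩ := heatDissipation_topEigMoment_eq_integral_of_midEig_lt hq1 hv hdv hU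
  have hgf : ∀ x : UnitAddTorus (Fin 3), ∃ (e : Fin 3 → ℝ) (lam g : ℝ), e ⬝ᵥ e = 1 ∧
      torusStrainMatrix v x *ᵥ e = lam • e ∧ 0 < g ∧
      ∀ w, w ⬝ᵥ e = 0 → w ⬝ᵥ torusStrainMatrix v x *ᵥ w ≤ (lam - g) * (w ⬝ᵥ w) := fun x => by
    obtain ⟨e, he1, hSe, hg, hgap⟩ := exists_gapForm_of_midEig_lt_topEig (hU x)
    exact ⟨e, _, _, he1, hSe, hg, hgap⟩
  have hls : Torus.IsSmooth (torusStrainTopEig v) := isSmooth_torusStrainTopEig_of_simple hv hgf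
  have hAi : ∀ k, Integrable (fun x => q * (q - 1) * torusStrainTopEig v x ^ (q - 2) *
      Torus.partialDeriv k (torusStrainTopEig v) x ^ 2) volume := fun k =>
    ((continuous_const.mul (hls.continuous.rpow_const fun _ => Or.inr (by linarith))).mul
      ((hls.partialDeriv k).continuous.pow 2)).integrable_unitAddTorus
  have hφ : Continuous fun x => q * torusStrainTopEig v x ^ (q - 1) :=
    continuous_const.mul (hls.continuous.rpow_const fun _ => Or.inr (by linarith))
  have hGi : Integrable (fun x => q * torusStrainTopEig v x ^ (q - 1) *
      (Torus.laplacian (torusStrainTopEig v) x -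
        dirTopEig (strainFlat v x) (strainFlat (Torus.laplacian v) x))) volume := by
    have h1 : Integrable (fun x => q * torusStrainTopEig v x ^ (q - 1) *
        Torus.laplacian (torusStrainTopEig v) x) volume :=
      (hφ.mul hls.laplacian.continuous).integrable_unitAddTorus
    have h2 := integrable_mul_dirTopEig hφ (continuous_strainFlat hv)
      (continuous_strainFlat hv.laplacian)
    simpa only [Pi.sub_def, mul_sub] using h1.sub h2
  simp only [frameDensity]
  simp_rw [Finset.mul_sum] at hheat
  rw [frameCost, hheat, integral_add (integrable_finsetSum _ fun k _ => hAi k) hGi,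
    integral_finsetSum _ fun k _ => hAi k, amplitudeIntegral, add_sub_cancel_left]

/-! ## § 4 Kill rule: the frame half of door (e) needs no simplicity hypothesis -/

/-- **KILL RULE (frame half of door (e), unconditional form).** If at a smooth divergence-free `v`
on `T³` the heat dissipation of `Φ_q` (`q ≥ 2`) is at most `c·Φ_q(v)`, then the gap-weighted turning
of the top eigenframe on the simple set obeys `∫_{U_s(v)} qλ₁^{q−1} fd ≤ c·Φ_q(v)`. Along a killing
family (`c → 0`) this integral must be `o(Φ_q)`: either the frame freezes where `λ₁` is simple, or the
gap closes there, or the mass of `λ₁^{q−1}·(turning)` escapes into `{λ₂ = λ₁}`. No claim beyond this. -/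
theorem setIntegral_simpleSet_frameDensity_le_of_heat_le (hq : 2 ≤ q) (hv : Torus.IsSmooth v)
    (hdv : Torus.IsDivFree v) {c : ℝ}
    (hc : heatDissipation (torusTopEigMoment q) v ≤ c * torusTopEigMoment q v) :
    ∫ x in simpleSet v, q * torusStrainTopEig v x ^ (q - 1) * frameDensity v x ≤
      c * torusTopEigMoment q v :=
  (setIntegral_simpleSet_frameDensity_le_frameCost hq hv hdv).2.trans
    (amplitude_le_and_frameCost_le_of_heat_le hq hv hdv hc).2

end Three

end FrameFloor

end TopEig

end Summit.NavierStokesRegularity.FunctionalMining
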